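import Summits.QuantumFields.YangMills.Theorems.BalabanUVNodesN10GenAnalyticReadingOfActivities
import Literature.MathematicalPhysics.QuantumFieldTheory.Balaban1983to89.B13Lemma3TorusSocket
import Literature.MathematicalPhysics.QuantumFieldTheory.Balaban1983to89.Node00.HistoryTermDatum214

/-!
# BalabanUVNodes ∕ N10 ([B13], `Dag.B13_main`, NODE A) → N22 (NE9): THE ANALYTIC READING OF def-W1's TERM-INDEXED GENERATORS FROM (2.26) PER TERM ON
# THE `Pot`-BALL — Lemma 3's resummation (2.26) ⟹ (2.38) for ANY configuration type (module 102 §1), hence module J58's rows `hGA ∧ hA ∧ hMbA` for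
# `GenTower.ofTerms L T` from per-term Banach readings + `Lemma3Numerics` + the two located [KP86] clauses (§2), and for def-W1's (2.14) TERM DATA
# `TermData214.Gn` from a reading section of Lemma 2's potentials + the per-term output of this lane's `B13TermDatum214ParamHolo` (§3)

Track A of `YM-PLAN.md` (cell `pub-ymgap`, HUMAN RULING D-0062), seat `pub-ymgap-dag-n10-c` g19, DAG edge **N10 → N22**, module 102 (sequel of module 101
`…Theorems.BalabanUVNodesN10GenAnalyticReadingOfActivities`, p663792).  THEOREMS ONLY (0 `def`, 0 `sorry`, standard axioms);
`--supports stmt-QuantumFields-27364 --as helper`; COUNT-NEUTRAL.  Interface row IR-N22-AR (lit-balaban iface-1 INTERFACES.md §3), producer side, file 2.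

WHY.  Module 101 reduced N22's generator-level analytic reading (J57∕J58: `hGA hA hMbA`) to three ACTIVITY-level rows, and (§3′ there) to per-TERM rows at def-W1's
term-indexed generator with Lemma 3's term count (Σ-38) DISPLAYED as a raw sum bound.  In the tree Lemma 3's count is a THEOREM on the papers' periodic carrier
(`B13Lemma3TorusTerms.hrep_of_termwise` ∘ `B13Lemma3Torus.bound238With_torus`, bundled by `B13Lemma3TorusSocket.h238_of_hRep_half` under ONE numerics record
`Lemma3Numerics c M (½L) a a₂ a₂′ a₅ A_abs`), read so far only in the CONFIGURATION direction (`Φ := CPair`, the N18 lane's `…N18HLayerW1Lemma3Config.bound238_of_termwise226_config`).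
Lemma 3 reads nothing of the configuration type: THIS FILE states it for ANY `Φ` and any table (§1) and reads it in the BANACH direction `Φ := Pot k` on the ball of the
older-term reading — so the (H-38) row of module 101 is DISCHARGED from (2.26) per term on that ball, with print's `A = C₃ε₁`, `R₃₈ = (1 − 8δ)·½L·κ`.
* §1 ★ `norm_le_238_of_termwise226` — for ANY configuration type `Φ`, table `spT`, activities `H Z : Φ → ℂ` and term maps `Tm Z s : Φ → ℂ` over the torus term catalogue
  `terms L M Z` of a `T4Family`'s step: termwise domination `‖H Z φ‖ ≤ Σ_s ‖Tm Z s φ‖` + (2.26) per term `‖Tm Z s φ‖ ≤ weight(s)·e^{a₅|Z|}` on the table + `Lemma3Numerics …` (`8 ≤ L`)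
  ⟹ **`‖H Z φ‖ ≤ C₃ε₁·e^{−(1−8δ)·½L·κ·d_{k+1}(Z)}`** on the table (`h238_of_hRep_half` on the inert two-torus step with `Φ`, `spT`, `H` only — the N18 pattern with `Φ` free).
* §2 ★★★ `exists_genAnalyticReading_ofTerms_of_termwise226` — at `Gn K := GenTower.ofTerms L (T K)` (every torus `K`): per-label Banach readings `a K k Z s t φ : Pot K k → ℂ`
  with (T-fact) on `Adm`, (T-holo) on `ball 0 R`, **(T-226) `‖a K k Z s t φ p‖ ≤ weight L M c Z a s·e^{a₅|Z|}` on `ball 0 R`** + `Lemma3Numerics c M (½L) …` + `0 ≤ C₃ε₁` + the N18-shaped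
  located clauses `r₁ + 2·(64·log 162) + 2 ≤ (1−8δ)·½L·κ`, `C₃ε₁·e^{5r₁+1}·K₀(64,8)·9·64 ≤ 1` ⟹ module J58 §1's rows **`hGA ∧ hA ∧ hMbA`** (K-indexed, ∃-form) with
  **`M_b = e·9·64·K₀(64,8)²·C₃ε₁`**, **`κ_E = r₁`** (§1 for (H-38), then module 101 `exists_genAnalyticReading_of_activityReading_family`).
* §3 ★★★ `exists_genAnalyticReading_termData_of_termwise226` — AT def-W1's (2.14) TERM DATA `(𝔇 K).Gn` (`Node00.HistoryTermDatum214`: `TermData214.Gn = GenTower.ofTerms L 𝔇.TF`,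
  `TF Z s t old φ := term214 …` print's display, the history entering ONLY through Lemma 2's potentials `𝒱` — `TF_congr_old`): a READING SECTION `cv K k : Pot K k → OlderTerms`
  reproducing the potentials of admissible histories (`(𝔇 K k).𝒱 Z s t (cv (ρA old)) φ = (𝔇 K k).𝒱 Z s t old φ` — print's (1.41) law reads the history through its values on the
  small-field tables, so any section agreeing there qualifies; DISPLAYED) + per term, along `cv` on `W := ball 0 R`, EXACTLY the output of this lane's
  `B13TermDatum214ParamHolo.h226T_of_inputs226Holo` (holomorphy ∧ the (2.26) weight, from ONE record of located (2.26) inputs + the potentials' three history letters) +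
  the numerics of §2 ⟹ the rows `hGA ∧ hA ∧ hMbA` for `(𝔇 K).Gn`.
* §4 (v1.1, APPEND-ONLY; declarations of v1 byte-identical) ★★ `activityReading_ofTerms_of_termwise226`, ★★ `activityReading_termData_of_termwise226` — the ACTIVITY-level
  triple (H-fact) ∧ (H-holo) ∧ (H-38) (`A = C₃ε₁`, `R₃₈ = (1−8δ)½Lκ`) EXPORTED (internal to §2 in v1): the input block of an activity-level consumer junction (the N22 lane's
  `…N22GenAnalyticReadingOfActivities` §2 `hHA hAh hmaj`, same shapes up to `rfl`).
So, for the generator of def-W1's term data, N22's (AR) block is reduced BY NAME to: NODE A's located (2.26) inputs per term (this lane's standing displayed class), Lemma 2's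
potentials read along a Banach section (holomorphic coordinatewise, measurable, (2.20) — def-W1's ∕ node N09's letters), `Lemma3Numerics`, two [KP86] clauses — and the two
reading-side rows (AR-adm)∕(AR-dom) of J58, which are the consumer's.

HONEST FRAMING (binding).  Kernel COMPOSITION of tree theorems (Lemma 3's torus resummation `B13Lemma3TorusSocket`, [KP86] holomorphy + (2.41) through module 101) with
def-W1's generators BY TYPING; (T-fact)∕(T-holo)∕(T-226), the reading section and the numerics are DISPLAYED HYPOTHESES (GAPS G-ne9p2-5 at the term level; NODE A's (2.26)
inputs are this lane's standing displayed class); NO estimate of Bałaban's is proved or asserted; nothing of the record is constructed.  N10 and N22 are NOT discharged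
(typed 28∕28 · discharged 5∕27 UNCHANGED); K1⁹ ∕ K3⁸ NOT closed, no stub touched; one finite 𝕋⁴ programme at fixed ε — NOTHING about the continuum limit, ℝ⁴, OS axioms, a mass
gap or the Clay problem is proved or claimed.  References (TYPES only): [II] = Bałaban, CMP 116 (1988) (1.41) p. 11, (2.13)–(2.15) pp. 14–15, (2.26) p. 17, Lemma 3 (2.38)
p. 20, (2.39)–(2.41) p. 21; [I] = CMP 109 (1987) (2.12)–(2.13) p. 268; [KP86] Theorem p. 492, p. 493.
-/

noncomputable section

open Set Metric
open scoped BigOperators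

namespace YMDAG.N10

open Literature.MathematicalPhysics.QuantumFieldTheory.Balaban1983to89
open Literature.MathematicalPhysics.QuantumFieldTheory.Balaban1983to89.T4Continuum (T4Family)
open Literature.MathematicalPhysics.QuantumFieldTheory.Balaban1983to89.B12TreeDecay (K₀ kappa₀)
open Literature.MathematicalPhysics.QuantumFieldTheory.Balaban1983to89.B13Lemma3Torus (TwoTorusStep)
open Literature.MathematicalPhysics.QuantumFieldTheory.Balaban1983to89.B13Lemma3TorusTerms (terms weight)
open Literature.MathematicalPhysics.QuantumFieldTheory.Balaban1983to89.B13Lemma3TorusSocket (Lemma3Numerics h238_of_hRep_half hRep_of_termwise)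
open Literature.MathematicalPhysics.QuantumFieldTheory.Balaban1983to89.Node00.Sect2 (domSys domCount CPair)
open Literature.MathematicalPhysics.QuantumFieldTheory.Balaban1983to89.Node00.W1

variable (F : T4Family) (K : ℕ) {M : ℕ} [NeZero M] (L : ℕ) [NeZero L]

/-! ## §1 ★ Lemma 3's resummation (2.26) ⟹ (2.38) for ANY configuration type and table -/

open Classical in
/-- ★ **LEMMA 3 ((2.26) PER TERM ⟹ (2.38)) FOR ANY CONFIGURATION TYPE `Φ` AND ANY TABLE.**  At step `k` of the torus `F.P K` (`𝐃_{k+1} = tsys 4 (domCount (F.P K) M (k+1))`,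
print's term catalogue `terms L M Z` of the labels `(𝐃, P)` with `Z′₀ ⊆ Z`): activities `H Z : Φ → ℂ` dominated termwise on the table `spT` (`‖H Z φ‖ ≤ Σ_{s ∈ terms L M Z} ‖Tm Z s φ‖`,
(2.9)∕(2.14)) and (2.26) per term there (`‖Tm Z s φ‖ ≤ weight L M c Z a s·e^{a₅|Z|}`, `B13Lemma3TorusTerms.weight`), under the printed restrictions on the constants bundled as
`Lemma3Numerics c M (½L) a a₂ a₂′ a₅ A_abs` (`8 ≤ L = c.L`) ⟹ **(2.38) `‖H Z φ‖ ≤ C₃ε₁·e^{−(1−8δ)·½L·κ·d_{k+1}(Z)}` on the table** — `B13Lemma3TorusSocket.h238_of_hRep_half`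
(Lemma 3's resummation pp. 17–20 + (2.36) at `ℓ = ½L`, kernel-checked) on the INERT two-torus step carrying only `Φ`, `spT`, `H` (the N18 lane's `bound238_of_hRep_config`
pattern with the configuration type free: here `Φ` may be a Banach space of older-term readings). [folklore] -/
theorem norm_le_238_of_termwise226 {k : ℕ} {Φ : Type} (spT : (domSys (F.P K) M (k + 1)).Dom → Set Φ) (H : (domSys (F.P K) M (k + 1)).Dom → Φ → ℂ)
    (Tm : (domSys (F.P K) M (k + 1)).Dom → TermLabel (F.P K) M k L → Φ → ℂ)
    (c : B13.Consts) (hL : 8 ≤ c.L) (hLc : c.L = L) {a a₂ a₂' a₅ Aabs : ℝ} (hN : Lemma3Numerics c M ((c.L : ℝ) / 2) a a₂ a₂' a₅ Aabs)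
    (hdom : ∀ (Z : (domSys (F.P K) M (k + 1)).Dom) (φ : Φ), φ ∈ spT Z → ‖H Z φ‖ ≤ ∑ s ∈ terms L M Z, ‖Tm Z s φ‖)
    (h226 : ∀ (Z : (domSys (F.P K) M (k + 1)).Dom) (φ : Φ), φ ∈ spT Z → ∀ s ∈ terms L M Z,
      ‖Tm Z s φ‖ ≤ weight L M c Z a s * Real.exp (a₅ * ((Z.1).card : ℝ))) :
    ∀ (Z : (domSys (F.P K) M (k + 1)).Dom) (φ : Φ), φ ∈ spT Z →
      ‖H Z φ‖ ≤ c.C3act * c.ε₁ * Real.exp (-((1 - 8 * c.δ) * ((c.L : ℝ) / 2) * c.κ * (domSys (F.P K) M (k + 1)).dj Z)) := by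
  intro Z φ hφ
  -- the socket at the inert two-torus step `(Φ, spT, H)` (a constant family over a dummy index)
  have h238 := h238_of_hRep_half c hL hLc (N' := fun _ : ℕ => domCount (F.P K) M (k + 1))
    (fun _ => (TwoTorusStep.mk (fun _ => 0) Φ PUnit (fun _ => ∅) spT (fun _ _ => 0) (fun _ _ => 0) (fun _ _ => 0)
      (fun _ _ _ _ => 0) (fun _ _ => 0) H (fun _ _ => 0) (fun _ _ => 0) (fun _ _ => True) (fun _ => True) True True :
        TwoTorusStep 4 L (domCount (F.P K) M (k + 1))))
    M hN (fun _ => hRep_of_termwise c (mul_nonneg hN.hα₆.le hN.hε₀) _ Tm hdom h226) 0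
  exact h238 Z φ hφ

/-! ## §2 ★★★ Module J58's rows for the term-indexed generators from (2.26) per term on the `Pot`-ball -/
section OfTerms

variable {𝔸 : Type} (T : (K : ℕ) → GenTermFun (F.P K) 𝔸 M L)
  (sp : (K k : ℕ) → (domSys (F.P K) M (k + 1)).Dom → Set (CPair (F.P K) 𝔸)) (Adm : (K k : ℕ) → OlderTerms (F.P K) 𝔸 M k → Prop)
  {Pot : ℕ → ℕ → Type} [∀ K k, NormedAddCommGroup (Pot K k)] [∀ K k, NormedSpace ℂ (Pot K k)]
  (ρA : (K k : ℕ) → OlderTerms (F.P K) 𝔸 M k → Pot K k)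
  (a : (K k : ℕ) → (domSys (F.P K) M (k + 1)).Dom → TermLabel (F.P K) M k L → ℝ → CPair (F.P K) 𝔸 → Pot K k → ℂ)

open Classical in
/-- ★★★ **MODULE J58's ANALYTIC-READING ROWS FOR THE TERM-INDEXED GENERATORS `GenTower.ofTerms L (T K)` FROM (2.26) PER TERM ON THE `Pot`-BALL.**  Per-label Banach
readings `a K k Z s t φ : Pot K k → ℂ` of the term functionals with (T-fact) `T K k Z s t old φ = a K k Z s t φ (ρA K k old)` on `Adm K k` (labels `s ∈ terms L M Z`, polymers
`Z ⊂ X`, `φ` in the table at `X`), (T-holo) complex differentiable on `ball 0 R`, **(T-226) `‖a K k Z s t φ p‖ ≤ weight L M c Z a s·e^{a₅|Z|}` on `ball 0 R`** ([II] (2.26) p. 17 read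
for the older terms as independent variables); `Lemma3Numerics c M (½L) …`, `8 ≤ L = c.L`, `0 ≤ C₃ε₁`; the located clauses `r₁ + 2·(64·log 162) + 2 ≤ (1−8δ)·½L·κ` and
`C₃ε₁·e^{5r₁+1}·K₀(64,8)·9·64 ≤ 1` ⟹ an analytic reading `A′ K k t φ X : Pot K k → ℂ` of `(GenTower.ofTerms L (T K) k).E` with (AR-fact), (AR-holo) on `ball 0 R` and (AR-bound)
at **`M_b = e·9·64·K₀(64,8)²·C₃ε₁`**, **`κ_E = r₁`** — (H-fact)∕(H-holo) finite sums, (H-38) by §1 at `Φ := Pot K k` on the table `{p | Z ⊂ X ∧ ‖p‖ < R}`, then module 101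
`exists_genAnalyticReading_of_activityReading_family`. [folklore] -/
theorem exists_genAnalyticReading_ofTerms_of_termwise226 (c : B13.Consts) (hL : 8 ≤ c.L) (hLc : c.L = L) {ar a₂ a₂' a₅ Aabs : ℝ}
    (hN : Lemma3Numerics c M ((c.L : ℝ) / 2) ar a₂ a₂' a₅ Aabs) (hA0 : 0 ≤ c.C3act * c.ε₁) {γ R r₁ : ℝ} (hr₁ : 0 ≤ r₁)
    (hrate : r₁ + 2 * (64 * Real.log 162) + 2 ≤ (1 - 8 * c.δ) * ((c.L : ℝ) / 2) * c.κ)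
    (hsmall : c.C3act * c.ε₁ * Real.exp (5 * r₁ + 1) * K₀ 64 8 * 9 * 64 ≤ 1)
    (hTa : ∀ (K k : ℕ), ∀ t ∈ Ioc (0 : ℝ) γ, ∀ (old : OlderTerms (F.P K) 𝔸 M k), Adm K k old → ∀ (X : (domSys (F.P K) M (k + 1)).Dom), ∀ φ ∈ sp K k X,
      ∀ Z : (domSys (F.P K) M (k + 1)).Dom, Subtype.val Z ⊆ Subtype.val X → ∀ s ∈ terms L M Z,
        T K k Z s ((t : ℝ) : ℂ) old φ = a K k Z s t φ (ρA K k old))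
    (hTh : ∀ (K k : ℕ), ∀ t ∈ Ioc (0 : ℝ) γ, ∀ (X : (domSys (F.P K) M (k + 1)).Dom), ∀ φ ∈ sp K k X,
      ∀ Z : (domSys (F.P K) M (k + 1)).Dom, Subtype.val Z ⊆ Subtype.val X → ∀ s ∈ terms L M Z, DifferentiableOn ℂ (a K k Z s t φ) (ball 0 R))
    (hT226 : ∀ (K k : ℕ), ∀ t ∈ Ioc (0 : ℝ) γ, ∀ (X : (domSys (F.P K) M (k + 1)).Dom), ∀ φ ∈ sp K k X,
      ∀ Z : (domSys (F.P K) M (k + 1)).Dom, Subtype.val Z ⊆ Subtype.val X → ∀ s ∈ terms L M Z, ∀ p ∈ ball (0 : Pot K k) R,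
        ‖a K k Z s t φ p‖ ≤ weight L M c Z ar s * Real.exp (a₅ * ((Z.1).card : ℝ))) :
    ∃ A' : (K k : ℕ) → ℝ → CPair (F.P K) 𝔸 → (domSys (F.P K) M (k + 1)).Dom → Pot K k → ℂ,
      (∀ (K k : ℕ), ∀ t ∈ Ioc (0 : ℝ) γ, ∀ (old : OlderTerms (F.P K) 𝔸 M k), Adm K k old → ∀ (X : (domSys (F.P K) M (k + 1)).Dom), ∀ φ ∈ sp K k X,
        (GenTower.ofTerms L (T K) k).E ((t : ℝ) : ℂ) old φ X = A' K k t φ X (ρA K k old)) ∧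
      (∀ (K k : ℕ), ∀ t ∈ Ioc (0 : ℝ) γ, ∀ (X : (domSys (F.P K) M (k + 1)).Dom), ∀ φ ∈ sp K k X, DifferentiableOn ℂ (A' K k t φ X) (ball 0 R)) ∧
      (∀ (K k : ℕ), ∀ t ∈ Ioc (0 : ℝ) γ, ∀ (X : (domSys (F.P K) M (k + 1)).Dom), ∀ φ ∈ sp K k X, ∀ p ∈ ball (0 : Pot K k) R,
        ‖A' K k t φ X p‖ ≤ Real.exp 1 * 9 * 64 * K₀ 64 8 ^ 2 * (c.C3act * c.ε₁) *
          Real.exp (-(r₁ * (domSys (F.P K) M (k + 1)).dj X))) := by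
  -- the three ACTIVITY-level rows for `h K k t φ Z p := Σ_{s ∈ terms L M Z} a K k Z s t φ p`
  have hHA : ∀ (K k : ℕ), ∀ t ∈ Ioc (0 : ℝ) γ, ∀ (old : OlderTerms (F.P K) 𝔸 M k), Adm K k old → ∀ (X : (domSys (F.P K) M (k + 1)).Dom), ∀ φ ∈ sp K k X,
      ∀ Z : (domSys (F.P K) M (k + 1)).Dom, Subtype.val Z ⊆ Subtype.val X →
        ((fun K => GenTower.ofTerms L (T K)) K k).H ((t : ℝ) : ℂ) old φ Z =
          (fun K k t φ (Z : (domSys (F.P K) M (k + 1)).Dom) (p : Pot K k) => ∑ s ∈ terms L M Z, a K k Z s t φ p) K k t φ Z (ρA K k old) := by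
    intro K k t ht old hold X φ hφ Z hZ
    show (GenTower.ofTerms L (T K) k).H ((t : ℝ) : ℂ) old φ Z = ∑ s ∈ terms L M Z, a K k Z s t φ (ρA K k old)
    rw [GenTower.ofTerms_apply, ofTerms_H]
    exact Finset.sum_congr rfl fun s hs => hTa K k t ht old hold X φ hφ Z hZ s hs
  have hHh : ∀ (K k : ℕ), ∀ t ∈ Ioc (0 : ℝ) γ, ∀ (X : (domSys (F.P K) M (k + 1)).Dom), ∀ φ ∈ sp K k X,
      ∀ Z : (domSys (F.P K) M (k + 1)).Dom, Subtype.val Z ⊆ Subtype.val X →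
        DifferentiableOn ℂ ((fun K k t φ (Z : (domSys (F.P K) M (k + 1)).Dom) (p : Pot K k) => ∑ s ∈ terms L M Z, a K k Z s t φ p) K k t φ Z)
          (ball 0 R) := by
    intro K k t ht X φ hφ Z hZ
    exact DifferentiableOn.fun_sum fun s hs => hTh K k t ht X φ hφ Z hZ s hs
  have hH38 : ∀ (K k : ℕ), ∀ t ∈ Ioc (0 : ℝ) γ, ∀ (X : (domSys (F.P K) M (k + 1)).Dom), ∀ φ ∈ sp K k X,
      ∀ Z : (domSys (F.P K) M (k + 1)).Dom, Subtype.val Z ⊆ Subtype.val X → ∀ p ∈ ball (0 : Pot K k) R,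
        ‖(fun K k t φ (Z : (domSys (F.P K) M (k + 1)).Dom) (p : Pot K k) => ∑ s ∈ terms L M Z, a K k Z s t φ p) K k t φ Z p‖ ≤
          c.C3act * c.ε₁ * Real.exp (-((1 - 8 * c.δ) * ((c.L : ℝ) / 2) * c.κ * (domSys (F.P K) M (k + 1)).dj Z)) := by
    intro K k t ht X φ hφ Z hZ p hp
    -- §1 at `Φ := Pot K k` on the table `{p | Z ⊂ X ∧ p ∈ ball 0 R}`
    have h := norm_le_238_of_termwise226 F K L (k := k) (Φ := Pot K k)
      (fun Z => {p | Subtype.val Z ⊆ Subtype.val X ∧ p ∈ ball (0 : Pot K k) R})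
      (fun Z p => ∑ s ∈ terms L M Z, a K k Z s t φ p) (fun Z s p => a K k Z s t φ p) c hL hLc hN
      (fun Z p _ => norm_sum_le _ _) (fun Z p hp' s hs => hT226 K k t ht X φ hφ Z hp'.1 s hs p hp'.2) Z p ⟨hZ, hp⟩
    exact h
  exact exists_genAnalyticReading_of_activityReading_family F (fun K => GenTower.ofTerms L (T K)) sp Adm ρA
    (fun K k t φ Z p => ∑ s ∈ terms L M Z, a K k Z s t φ p) hA0 hr₁ hrate hsmall hHA hHh hH38

end OfTerms

/-! ## §3 ★★★ At def-W1's (2.14) TERM DATA `TermData214.Gn`: a reading section of Lemma 2's potentials + the per-term output of `B13TermDatum214ParamHolo` -/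
section TermData

variable {𝔸 : Type} {c₀ : B13.Consts} (𝔇 : (K : ℕ) → TermData214 c₀ (F.P K) 𝔸 M L)
  (sp : (K k : ℕ) → (domSys (F.P K) M (k + 1)).Dom → Set (CPair (F.P K) 𝔸)) (Adm : (K k : ℕ) → OlderTerms (F.P K) 𝔸 M k → Prop)
  {Pot : ℕ → ℕ → Type} [∀ K k, NormedAddCommGroup (Pot K k)] [∀ K k, NormedSpace ℂ (Pot K k)]
  (ρA : (K k : ℕ) → OlderTerms (F.P K) 𝔸 M k → Pot K k) (cv : (K k : ℕ) → Pot K k → OlderTerms (F.P K) 𝔸 M k)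

open Classical in
/-- ★★★ **MODULE J58's ANALYTIC-READING ROWS FOR def-W1's TERM-DATA GENERATORS `(𝔇 K).Gn`.**  For (2.14) term data `𝔇 K : TermData214 c₀ (F.P K) 𝔸 M L` (def-W1
`Node00.HistoryTermDatum214`; `(𝔇 K).Gn = GenTower.ofTerms L (𝔇 K).TF`), readings `ρA K k : OlderTerms → Pot K k` with a READING SECTION `cv K k : Pot K k → OlderTerms` that
REPRODUCES LEMMA 2's POTENTIALS OF ADMISSIBLE HISTORIES — `(𝔇 K k).𝒱 Z s t (cv (ρA old)) φ = (𝔇 K k).𝒱 Z s t old φ` on `Adm K k` (labels of the polymers `Z ⊂ X`, `φ` in the table;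
print's (1.41) law reads the history through its values on the small-field tables, DISPLAYED) — and, per term along `cv` on `W := ball 0 R`, EXACTLY the output of this lane's
`B13TermDatum214ParamHolo.h226T_of_inputs226Holo`: `DifferentiableOn ℂ (p ↦ (𝔇 K k).TF Z s t (cv p) φ) (ball 0 R) ∧ ‖(𝔇 K k).TF Z s t (cv p) φ‖ ≤ weight L M c Z a s·e^{a₅|Z|}` there;
`Lemma3Numerics c M (½L) …`, `8 ≤ L = c.L`, `0 ≤ C₃ε₁`, the two located clauses ⟹ an analytic reading `A′` of `((𝔇 K).Gn k).E` with (AR-fact), (AR-holo) on `ball 0 R`, (AR-bound)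
at `M_b = e·9·64·K₀(64,8)²·C₃ε₁`, `κ_E = r₁` — (T-fact) by `TF_congr_old` (the history enters through `𝒱` only), then §2. [folklore] -/
theorem exists_genAnalyticReading_termData_of_termwise226 (c : B13.Consts) (hL : 8 ≤ c.L) (hLc : c.L = L) {ar a₂ a₂' a₅ Aabs : ℝ}
    (hN : Lemma3Numerics c M ((c.L : ℝ) / 2) ar a₂ a₂' a₅ Aabs) (hA0 : 0 ≤ c.C3act * c.ε₁) {γ R r₁ : ℝ} (hr₁ : 0 ≤ r₁)
    (hrate : r₁ + 2 * (64 * Real.log 162) + 2 ≤ (1 - 8 * c.δ) * ((c.L : ℝ) / 2) * c.κ)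
    (hsmall : c.C3act * c.ε₁ * Real.exp (5 * r₁ + 1) * K₀ 64 8 * 9 * 64 ≤ 1)
    (hcv : ∀ (K k : ℕ), ∀ t ∈ Ioc (0 : ℝ) γ, ∀ (old : OlderTerms (F.P K) 𝔸 M k), Adm K k old → ∀ (X : (domSys (F.P K) M (k + 1)).Dom), ∀ φ ∈ sp K k X,
      ∀ Z : (domSys (F.P K) M (k + 1)).Dom, Subtype.val Z ⊆ Subtype.val X → ∀ s ∈ terms L M Z,
        ∀ Y B, (𝔇 K k).𝒱 Z s ((t : ℝ) : ℂ) (cv K k (ρA K k old)) φ Y B = (𝔇 K k).𝒱 Z s ((t : ℝ) : ℂ) old φ Y B)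
    (hT : ∀ (K k : ℕ), ∀ t ∈ Ioc (0 : ℝ) γ, ∀ (X : (domSys (F.P K) M (k + 1)).Dom), ∀ φ ∈ sp K k X,
      ∀ Z : (domSys (F.P K) M (k + 1)).Dom, Subtype.val Z ⊆ Subtype.val X → ∀ s ∈ terms L M Z,
        DifferentiableOn ℂ (fun p => (𝔇 K k).TF Z s ((t : ℝ) : ℂ) (cv K k p) φ) (ball 0 R) ∧
          ∀ p ∈ ball (0 : Pot K k) R, ‖(𝔇 K k).TF Z s ((t : ℝ) : ℂ) (cv K k p) φ‖ ≤ weight L M c Z ar s * Real.exp (a₅ * ((Z.1).card : ℝ))) :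
    ∃ A' : (K k : ℕ) → ℝ → CPair (F.P K) 𝔸 → (domSys (F.P K) M (k + 1)).Dom → Pot K k → ℂ,
      (∀ (K k : ℕ), ∀ t ∈ Ioc (0 : ℝ) γ, ∀ (old : OlderTerms (F.P K) 𝔸 M k), Adm K k old → ∀ (X : (domSys (F.P K) M (k + 1)).Dom), ∀ φ ∈ sp K k X,
        ((𝔇 K).Gn k).E ((t : ℝ) : ℂ) old φ X = A' K k t φ X (ρA K k old)) ∧
      (∀ (K k : ℕ), ∀ t ∈ Ioc (0 : ℝ) γ, ∀ (X : (domSys (F.P K) M (k + 1)).Dom), ∀ φ ∈ sp K k X, DifferentiableOn ℂ (A' K k t φ X) (ball 0 R)) ∧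
      (∀ (K k : ℕ), ∀ t ∈ Ioc (0 : ℝ) γ, ∀ (X : (domSys (F.P K) M (k + 1)).Dom), ∀ φ ∈ sp K k X, ∀ p ∈ ball (0 : Pot K k) R,
        ‖A' K k t φ X p‖ ≤ Real.exp 1 * 9 * 64 * K₀ 64 8 ^ 2 * (c.C3act * c.ε₁) *
          Real.exp (-(r₁ * (domSys (F.P K) M (k + 1)).dj X))) :=
  -- §2 at `T K := (𝔇 K).TF`, `a K k Z s t φ p := (𝔇 K k).TF Z s t (cv p) φ`; (T-fact) = `TF_congr_old` on the reading section
  exists_genAnalyticReading_ofTerms_of_termwise226 F L (fun K => (𝔇 K).TF) sp Adm ρA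
    (fun K k Z s t φ p => (𝔇 K k).TF Z s ((t : ℝ) : ℂ) (cv K k p) φ) c hL hLc hN hA0 hr₁ hrate hsmall
    (fun K k t ht old hold X φ hφ Z hZ s hs =>
      (𝔇 K k).TF_congr_old Z s ((t : ℝ) : ℂ) φ fun Y B => (hcv K k t ht old hold X φ hφ Z hZ s hs Y B).symm)
    (fun K k t ht X φ hφ Z hZ s hs => (hT K k t ht X φ hφ Z hZ s hs).1)
    (fun K k t ht X φ hφ Z hZ s hs => (hT K k t ht X φ hφ Z hZ s hs).2)

end TermData

/-! ## §4 (v1.1, append-only) The ACTIVITY-level triple exported — the input block of the consumer's activity-level junction -/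
section ActivityExport

variable {𝔸 : Type} (T : (K : ℕ) → GenTermFun (F.P K) 𝔸 M L)
  (sp : (K k : ℕ) → (domSys (F.P K) M (k + 1)).Dom → Set (CPair (F.P K) 𝔸)) (Adm : (K k : ℕ) → OlderTerms (F.P K) 𝔸 M k → Prop)
  {Pot : ℕ → ℕ → Type} [∀ K k, NormedAddCommGroup (Pot K k)] [∀ K k, NormedSpace ℂ (Pot K k)]
  (ρA : (K k : ℕ) → OlderTerms (F.P K) 𝔸 M k → Pot K k)
  (a : (K k : ℕ) → (domSys (F.P K) M (k + 1)).Dom → TermLabel (F.P K) M k L → ℝ → CPair (F.P K) 𝔸 → Pot K k → ℂ)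

open Classical in
/-- ★★ **(v1.1) THE ACTIVITY-LEVEL TRIPLE FOR THE TERM-INDEXED GENERATORS, EXPORTED.**  Per-label Banach readings with (T-fact)∕(T-holo)∕(T-226) + `Lemma3Numerics c M (½L) …`
(`8 ≤ L = c.L`) ⟹ for the activity reading **`h K k t φ Z p := Σ_{s ∈ terms L M Z} a K k Z s t φ p`** of `Gn K := GenTower.ofTerms L (T K)`: (H-fact) on `Adm`, (H-holo) on `ball 0 R`,
(H-38) `‖h K k t φ Z p‖ ≤ C₃ε₁·e^{−(1−8δ)·½L·κ·d_{k+1}(Z)}` there (§1) — the block `hHA ∧ hAh ∧ hmaj` an activity-level consumer junction takes (e.g. the N22 lane's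
`…N22GenAnalyticReadingOfActivities` §2, whose `Z.1 ⊆ X.1` ∕ `torusTreeLen Z.1` are this file's `Subtype.val Z ⊆ Subtype.val X` ∕ `(domSys …).dj Z` by `rfl`); it was internal
to §2's proof in v1. [folklore] -/
theorem activityReading_ofTerms_of_termwise226 (c : B13.Consts) (hL : 8 ≤ c.L) (hLc : c.L = L) {ar a₂ a₂' a₅ Aabs : ℝ}
    (hN : Lemma3Numerics c M ((c.L : ℝ) / 2) ar a₂ a₂' a₅ Aabs) {γ R : ℝ}
    (hTa : ∀ (K k : ℕ), ∀ t ∈ Ioc (0 : ℝ) γ, ∀ (old : OlderTerms (F.P K) 𝔸 M k), Adm K k old → ∀ (X : (domSys (F.P K) M (k + 1)).Dom), ∀ φ ∈ sp K k X,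
      ∀ Z : (domSys (F.P K) M (k + 1)).Dom, Subtype.val Z ⊆ Subtype.val X → ∀ s ∈ terms L M Z,
        T K k Z s ((t : ℝ) : ℂ) old φ = a K k Z s t φ (ρA K k old))
    (hTh : ∀ (K k : ℕ), ∀ t ∈ Ioc (0 : ℝ) γ, ∀ (X : (domSys (F.P K) M (k + 1)).Dom), ∀ φ ∈ sp K k X,
      ∀ Z : (domSys (F.P K) M (k + 1)).Dom, Subtype.val Z ⊆ Subtype.val X → ∀ s ∈ terms L M Z, DifferentiableOn ℂ (a K k Z s t φ) (ball 0 R))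
    (hT226 : ∀ (K k : ℕ), ∀ t ∈ Ioc (0 : ℝ) γ, ∀ (X : (domSys (F.P K) M (k + 1)).Dom), ∀ φ ∈ sp K k X,
      ∀ Z : (domSys (F.P K) M (k + 1)).Dom, Subtype.val Z ⊆ Subtype.val X → ∀ s ∈ terms L M Z, ∀ p ∈ ball (0 : Pot K k) R,
        ‖a K k Z s t φ p‖ ≤ weight L M c Z ar s * Real.exp (a₅ * ((Z.1).card : ℝ))) :
    (∀ (K k : ℕ), ∀ t ∈ Ioc (0 : ℝ) γ, ∀ (old : OlderTerms (F.P K) 𝔸 M k), Adm K k old → ∀ (X : (domSys (F.P K) M (k + 1)).Dom), ∀ φ ∈ sp K k X,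
      ∀ Z : (domSys (F.P K) M (k + 1)).Dom, Subtype.val Z ⊆ Subtype.val X →
        (GenTower.ofTerms L (T K) k).H ((t : ℝ) : ℂ) old φ Z =
          (fun K k t φ (Z : (domSys (F.P K) M (k + 1)).Dom) (p : Pot K k) => ∑ s ∈ terms L M Z, a K k Z s t φ p) K k t φ Z (ρA K k old)) ∧
    (∀ (K k : ℕ), ∀ t ∈ Ioc (0 : ℝ) γ, ∀ (X : (domSys (F.P K) M (k + 1)).Dom), ∀ φ ∈ sp K k X,
      ∀ Z : (domSys (F.P K) M (k + 1)).Dom, Subtype.val Z ⊆ Subtype.val X →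
        DifferentiableOn ℂ ((fun K k t φ (Z : (domSys (F.P K) M (k + 1)).Dom) (p : Pot K k) => ∑ s ∈ terms L M Z, a K k Z s t φ p) K k t φ Z)
          (ball 0 R)) ∧
    (∀ (K k : ℕ), ∀ t ∈ Ioc (0 : ℝ) γ, ∀ (X : (domSys (F.P K) M (k + 1)).Dom), ∀ φ ∈ sp K k X,
      ∀ Z : (domSys (F.P K) M (k + 1)).Dom, Subtype.val Z ⊆ Subtype.val X → ∀ p ∈ ball (0 : Pot K k) R,
        ‖(fun K k t φ (Z : (domSys (F.P K) M (k + 1)).Dom) (p : Pot K k) => ∑ s ∈ terms L M Z, a K k Z s t φ p) K k t φ Z p‖ ≤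
          c.C3act * c.ε₁ * Real.exp (-((1 - 8 * c.δ) * ((c.L : ℝ) / 2) * c.κ * (domSys (F.P K) M (k + 1)).dj Z))) := by
  refine ⟨fun K k t ht old hold X φ hφ Z hZ => ?_, fun K k t ht X φ hφ Z hZ => ?_, fun K k t ht X φ hφ Z hZ p hp => ?_⟩
  · show (GenTower.ofTerms L (T K) k).H ((t : ℝ) : ℂ) old φ Z = ∑ s ∈ terms L M Z, a K k Z s t φ (ρA K k old)
    rw [GenTower.ofTerms_apply, ofTerms_H]
    exact Finset.sum_congr rfl fun s hs => hTa K k t ht old hold X φ hφ Z hZ s hs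
  · exact DifferentiableOn.fun_sum fun s hs => hTh K k t ht X φ hφ Z hZ s hs
  · exact norm_le_238_of_termwise226 F K L (k := k) (Φ := Pot K k)
      (fun Z => {p | Subtype.val Z ⊆ Subtype.val X ∧ p ∈ ball (0 : Pot K k) R})
      (fun Z p => ∑ s ∈ terms L M Z, a K k Z s t φ p) (fun Z s p => a K k Z s t φ p) c hL hLc hN
      (fun Z p _ => norm_sum_le _ _) (fun Z p hp' s hs => hT226 K k t ht X φ hφ Z hp'.1 s hs p hp'.2) Z p ⟨hZ, hp⟩

end ActivityExport

section TermDataExport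

variable {𝔸 : Type} {c₀ : B13.Consts} (𝔇 : (K : ℕ) → TermData214 c₀ (F.P K) 𝔸 M L)
  (sp : (K k : ℕ) → (domSys (F.P K) M (k + 1)).Dom → Set (CPair (F.P K) 𝔸)) (Adm : (K k : ℕ) → OlderTerms (F.P K) 𝔸 M k → Prop)
  {Pot : ℕ → ℕ → Type} [∀ K k, NormedAddCommGroup (Pot K k)] [∀ K k, NormedSpace ℂ (Pot K k)]
  (ρA : (K k : ℕ) → OlderTerms (F.P K) 𝔸 M k → Pot K k) (cv : (K k : ℕ) → Pot K k → OlderTerms (F.P K) 𝔸 M k)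

open Classical in
/-- ★★ **(v1.1) THE ACTIVITY-LEVEL TRIPLE FOR def-W1's TERM-DATA GENERATORS `(𝔇 K).Gn`, EXPORTED**: a reading section of Lemma 2's potentials (`hcv`) + per term the output of this
lane's `B13TermDatum214ParamHolo.h226T_of_inputs226Holo` along `cv` on `ball 0 R` + `Lemma3Numerics` ⟹ (H-fact) ∧ (H-holo) ∧ (H-38) for
**`h K k t φ Z p := Σ_{s ∈ terms L M Z} (𝔇 K k).TF Z s t (cv p) φ`** (§4's triple at `T K := (𝔇 K).TF`; (T-fact) by `TF_congr_old`). [folklore] -/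
theorem activityReading_termData_of_termwise226 (c : B13.Consts) (hL : 8 ≤ c.L) (hLc : c.L = L) {ar a₂ a₂' a₅ Aabs : ℝ}
    (hN : Lemma3Numerics c M ((c.L : ℝ) / 2) ar a₂ a₂' a₅ Aabs) {γ R : ℝ}
    (hcv : ∀ (K k : ℕ), ∀ t ∈ Ioc (0 : ℝ) γ, ∀ (old : OlderTerms (F.P K) 𝔸 M k), Adm K k old → ∀ (X : (domSys (F.P K) M (k + 1)).Dom), ∀ φ ∈ sp K k X,
      ∀ Z : (domSys (F.P K) M (k + 1)).Dom, Subtype.val Z ⊆ Subtype.val X → ∀ s ∈ terms L M Z,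
        ∀ Y B, (𝔇 K k).𝒱 Z s ((t : ℝ) : ℂ) (cv K k (ρA K k old)) φ Y B = (𝔇 K k).𝒱 Z s ((t : ℝ) : ℂ) old φ Y B)
    (hT : ∀ (K k : ℕ), ∀ t ∈ Ioc (0 : ℝ) γ, ∀ (X : (domSys (F.P K) M (k + 1)).Dom), ∀ φ ∈ sp K k X,
      ∀ Z : (domSys (F.P K) M (k + 1)).Dom, Subtype.val Z ⊆ Subtype.val X → ∀ s ∈ terms L M Z,
        DifferentiableOn ℂ (fun p => (𝔇 K k).TF Z s ((t : ℝ) : ℂ) (cv K k p) φ) (ball 0 R) ∧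
          ∀ p ∈ ball (0 : Pot K k) R, ‖(𝔇 K k).TF Z s ((t : ℝ) : ℂ) (cv K k p) φ‖ ≤ weight L M c Z ar s * Real.exp (a₅ * ((Z.1).card : ℝ))) :
    (∀ (K k : ℕ), ∀ t ∈ Ioc (0 : ℝ) γ, ∀ (old : OlderTerms (F.P K) 𝔸 M k), Adm K k old → ∀ (X : (domSys (F.P K) M (k + 1)).Dom), ∀ φ ∈ sp K k X,
      ∀ Z : (domSys (F.P K) M (k + 1)).Dom, Subtype.val Z ⊆ Subtype.val X →
        ((𝔇 K).Gn k).H ((t : ℝ) : ℂ) old φ Z =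
          (fun K k t φ (Z : (domSys (F.P K) M (k + 1)).Dom) (p : Pot K k) => ∑ s ∈ terms L M Z, (𝔇 K k).TF Z s ((t : ℝ) : ℂ) (cv K k p) φ) K k t φ Z
            (ρA K k old)) ∧
    (∀ (K k : ℕ), ∀ t ∈ Ioc (0 : ℝ) γ, ∀ (X : (domSys (F.P K) M (k + 1)).Dom), ∀ φ ∈ sp K k X,
      ∀ Z : (domSys (F.P K) M (k + 1)).Dom, Subtype.val Z ⊆ Subtype.val X →
        DifferentiableOn ℂ
          ((fun K k t φ (Z : (domSys (F.P K) M (k + 1)).Dom) (p : Pot K k) => ∑ s ∈ terms L M Z, (𝔇 K k).TF Z s ((t : ℝ) : ℂ) (cv K k p) φ) K k t φ Z)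
          (ball 0 R)) ∧
    (∀ (K k : ℕ), ∀ t ∈ Ioc (0 : ℝ) γ, ∀ (X : (domSys (F.P K) M (k + 1)).Dom), ∀ φ ∈ sp K k X,
      ∀ Z : (domSys (F.P K) M (k + 1)).Dom, Subtype.val Z ⊆ Subtype.val X → ∀ p ∈ ball (0 : Pot K k) R,
        ‖(fun K k t φ (Z : (domSys (F.P K) M (k + 1)).Dom) (p : Pot K k) => ∑ s ∈ terms L M Z, (𝔇 K k).TF Z s ((t : ℝ) : ℂ) (cv K k p) φ) K k t φ Z p‖ ≤
          c.C3act * c.ε₁ * Real.exp (-((1 - 8 * c.δ) * ((c.L : ℝ) / 2) * c.κ * (domSys (F.P K) M (k + 1)).dj Z))) :=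
  activityReading_ofTerms_of_termwise226 F L (fun K => (𝔇 K).TF) sp Adm ρA
    (fun K k Z s t φ p => (𝔇 K k).TF Z s ((t : ℝ) : ℂ) (cv K k p) φ) c hL hLc hN
    (fun K k t ht old hold X φ hφ Z hZ s hs =>
      (𝔇 K k).TF_congr_old Z s ((t : ℝ) : ℂ) φ fun Y B => (hcv K k t ht old hold X φ hφ Z hZ s hs Y B).symm)
    (fun K k t ht X φ hφ Z hZ s hs => (hT K k t ht X φ hφ Z hZ s hs).1)
    (fun K k t ht X φ hφ Z hZ s hs => (hT K k t ht X φ hφ Z hZ s hs).2)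

end TermDataExport

end YMDAG.N10

end
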